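import Literature.AnabelianGeometry.AbsoluteAnabelian.MonoidKummerMapsUnitPairProofs
import Literature.AnabelianGeometry.AbsoluteAnabelian.MonoidKummerMapsProofs
import Literature.AnabelianGeometry.AbsoluteAnabelian.MLFClosureUnitsInfinitelyDivisible
import Literature.AnabelianGeometry.AbsoluteAnabelian.MLFGaloisPairsWitness
import Mathlib.FieldTheory.Galois.Infinite
import HarnessLib

/-!
# Units, integers and a uniformizer of `k̄` in Galois-theoretic terms; arithmetic kernels of model pairs

Proof-only companion (theorems only, no new definitions) of `MLFGaloisModel.lean` /
`MLFGaloisModelPairs.lean` / `MonoidKummerMaps.lean` (seat abc-iut-L4-t2; S. Mochizuki, *Topics in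
Absolute Anabelian Geometry III*, Def. 3.1 (i)(ii) pp. 66–67, Rmk. 3.1.1 p. 70, kurims manuscript, lit
key `paper:url-5493eb38cbb7`), preparing the reduction of Prop. 3.2 (iv) (`T = TM`) to the `TLG`
lifting statement (`MonoidKummerMapsTMLiftProofs.lean`).  For an MLF `k` with algebraic closure `k̄`
(`C : MLFClosure`):

* `MLFClosure.mem_unitSubmonoid_iff_exists_prime_forall_exists_fixed_pow_eq` — Remark 3.1.1 in
  GALOIS-THEORETIC form: `x ≠ 0` is a unit of `𝒪_k̄` iff for some prime `ℓ` and all `n` it has an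
  `ℓⁿ`-th root fixed by every element of `G_k` fixing `x` (from abc-iut-L6-t11's
  `mem_unitSubmonoid_iff_exists_prime_forall_exists_pow_eq` and `k(x) = k̄^{Stab(x)}`);
* `MLFClosure.mem_nonzeroIntegers_or_inv_mem` — for `x ≠ 0`, `x ∈ 𝒪_k̄` or `x⁻¹ ∈ 𝒪_k̄` (valuation of
  the local field `k(x)`, tree `FiniteExtension.*`);
* `MLFClosure.exists_anchor` — there is `ϖ ∈ 𝒪_k̄^⊳` with `ϖ⁻¹ ∉ 𝒪_k̄^⊳` such that every integral
  non-unit `x` satisfies `x^m = ϖⁿ·u`, `m ≥ 1`, `u ∈ 𝒪_k̄^×` (discreteness of the valuation of `k(x)`,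
  via Mathlib `IsNonarchimedeanLocalField.valueGroupWithZeroIsoInt`);
* `GaloisMonoidPair.mem_actionKer_iff`, `GaloisMonoidPair.Iso.map_actionKer` /
  `.symm_map_actionKer` (isomorphisms of pairs respect the arithmetic quotients), and
  `ModelMLFGaloisData.tmPair_actionKer` / `.tlgPair_actionKer` (for the model `TM`- and `TLG`-pairs the
  arithmetic kernel is `Ker ε_k`, `G_k` acting faithfully on `𝒪_k̄^⊳`, `k̄^×`).

Refs: Serre, *Local Fields*, Ch. II §2 Prop. 3 (integers of a finite extension).
HONEST FRAMING: OUR kernel check of classical facts quoted by a refereed paper; nothing here bears on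
[IUTchIII] Cor. 3.12.
-/

noncomputable section

open scoped Classical

namespace Literature.AnabelianGeometry.AbsoluteAnabelian

open _root_.ValuativeRel IntermediateField
open Literature.NumberTheory.GaloisRepresentations

universe u

/-! ### §1. Inside one algebraic closure: units, integers, and a uniformizer -/

namespace MLFClosure

variable (C : MLFClosure.{u})

/-- `k(x)` is the fixed field of the stabiliser of `x`: `y ∈ k(x)` iff every element of `G_k` fixing
`x` fixes `y` (infinite Galois correspondence, `k(x)/k` finite). [folklore] -/
private theorem mem_adjoin_simple_iff_forall_fixed {x y : C.K} :
    y ∈ IntermediateField.adjoin C.k ({x} : Set C.K) ↔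
      ∀ τ : C.K ≃ₐ[C.k] C.K, τ x = x → τ y = y := by
  constructor
  · intro hy τ hτ
    have hle : IntermediateField.adjoin C.k ({x} : Set C.K) ≤
        IntermediateField.fixedField (MulAction.stabilizer (C.K ≃ₐ[C.k] C.K) x) :=
      IntermediateField.adjoin_simple_le_iff.mpr
        ((IntermediateField.mem_fixedField_iff _ _).mpr fun σ hσ => hσ)
    exact (IntermediateField.mem_fixedField_iff _ _).mp (hle hy) τ hτ
  · -- adapted from `MonoidKummerMapsProofs.mem_adjoin_of_fixed` (abc-iut-L6-t13)
    intro h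
    rw [← InfiniteGalois.fixedField_fixingSubgroup (IntermediateField.adjoin C.k ({x} : Set C.K)),
      IntermediateField.mem_fixedField_iff]
    intro τ hτ
    exact h τ ((IntermediateField.mem_fixingSubgroup_iff _ _).mp hτ x
      (IntermediateField.mem_adjoin_simple_self C.k x))

/-- **Remark 3.1.1, Galois-theoretic form.**  A non-zero `x ∈ k̄` is a unit of `𝒪_k̄` iff for some
prime `ℓ` and every `n` it has an `ℓⁿ`-th root fixed by every element of `G_k` that fixes `x`.
[cite: MochizukiAbsTopIII2015, Remark 3.1.1 p.70] -/
theorem mem_unitSubmonoid_iff_exists_prime_forall_exists_fixed_pow_eq {x : C.K} (hx : x ≠ 0) :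
    x ∈ unitSubmonoid C.k C.K ↔ ∃ ℓ : ℕ, ℓ.Prime ∧ ∀ n : ℕ, ∃ y : C.K,
      (∀ τ : C.K ≃ₐ[C.k] C.K, τ x = x → τ y = y) ∧ y ^ (ℓ ^ n) = x := by
  rw [C.mem_unitSubmonoid_iff_exists_prime_forall_exists_pow_eq hx]
  simp only [C.mem_adjoin_simple_iff_forall_fixed]

/-- Units are stable under inversion: `x ∈ 𝒪_k̄^× → x⁻¹ ∈ 𝒪_k̄^×`.
[cite: MochizukiAbsTopIII2015, Definition 3.1 (i) p.66] -/
theorem inv_mem_unitSubmonoid {x : C.K} (hx : x ∈ unitSubmonoid C.k C.K) :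
    x⁻¹ ∈ unitSubmonoid C.k C.K := by
  rw [mem_unitSubmonoid_iff] at hx ⊢
  exact ⟨inv_ne_zero hx.1, hx.2.2, by rw [inv_inv]; exact hx.2.1⟩

/-- A unit is a non-zero integer, and so is its inverse. [cite: MochizukiAbsTopIII2015, Definition 3.1 (i) p.66] -/
theorem mem_nonzeroIntegers_of_mem_unitSubmonoid {x : C.K} (hx : x ∈ unitSubmonoid C.k C.K) :
    x ∈ nonzeroIntegers C.k C.K :=
  unitSubmonoid_le_nonzeroIntegers hx

/-- `𝒪_k̄^× = 𝒪_k̄^⊳ ∩ (𝒪_k̄^⊳)⁻¹`. [cite: MochizukiAbsTopIII2015, Definition 3.1 (i) p.66] -/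
theorem mem_unitSubmonoid_iff_mem_nonzeroIntegers_and_inv_mem {x : C.K} :
    x ∈ unitSubmonoid C.k C.K ↔ x ∈ nonzeroIntegers C.k C.K ∧ x⁻¹ ∈ nonzeroIntegers C.k C.K := by
  rw [mem_unitSubmonoid_iff]
  constructor
  · rintro ⟨h0, h1, h2⟩
    exact ⟨⟨h1, h0⟩, ⟨h2, inv_ne_zero h0⟩⟩
  · rintro ⟨⟨h1, h0⟩, ⟨h2, -⟩⟩
    exact ⟨h0, h1, h2⟩

/-- **Trichotomy of the valuation on `k̄`**: for `x ≠ 0`, `x` or `x⁻¹` is an integer (read in the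
local field `k(x)`). [cite: MochizukiAbsTopIII2015, Definition 3.1 (i) p.66] -/
theorem mem_nonzeroIntegers_or_inv_mem {x : C.K} (hx : x ≠ 0) :
    x ∈ nonzeroIntegers C.k C.K ∨ x⁻¹ ∈ nonzeroIntegers C.k C.K := by
  have hxk : IsIntegral C.k x := Algebra.IsIntegral.isIntegral x
  haveI : FiniteDimensional C.k (IntermediateField.adjoin C.k ({x} : Set C.K)) :=
    IntermediateField.adjoin.finiteDimensional hxk
  letI := FiniteExtension.valuativeRel C.k (IntermediateField.adjoin C.k ({x} : Set C.K))
  have hx'0 : IntermediateField.AdjoinSimple.gen C.k x ≠ 0 := fun h =>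
    hx (congrArg (fun z : IntermediateField.adjoin C.k ({x} : Set C.K) => (z : C.K)) h)
  have key := FiniteExtension.mem_integer_iff_isIntegral C.k
    (IntermediateField.adjoin C.k ({x} : Set C.K))
  rcases le_total (valuation (IntermediateField.adjoin C.k ({x} : Set C.K))
    (IntermediateField.AdjoinSimple.gen C.k x)) 1 with h | h
  · left
    refine ⟨?_, hx⟩
    have h1 := (key _).mp ((Valuation.mem_integer_iff _ _).mpr h)
    exact (IntermediateField.isIntegral_coe_iff C.k C.K _
      (IntermediateField.AdjoinSimple.gen C.k x)).mpr h1
  · right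
    refine ⟨?_, inv_ne_zero hx⟩
    have hv : valuation (IntermediateField.adjoin C.k ({x} : Set C.K))
        (IntermediateField.AdjoinSimple.gen C.k x)⁻¹ ≤ 1 := by
      rw [map_inv₀]
      exact inv_le_one_of_one_le₀ h
    have h1 := (key _).mp ((Valuation.mem_integer_iff _ _).mpr hv)
    exact (IntermediateField.isIntegral_coe_iff C.k C.K _
      (IntermediateField.AdjoinSimple.gen C.k x)⁻¹).mpr h1

/-- An integer-valued order function on a non-archimedean local field (the logarithm of the
valuation read in `ℤ` through `valueGroupWithZeroIsoInt`). [folklore] -/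
private theorem exists_ord_fun (L : Type u) [Field L] [ValuativeRel L] [TopologicalSpace L]
    [IsNonarchimedeanLocalField L] :
    ∃ ord : L → ℤ,
      (∀ a b : L, a ≠ 0 → b ≠ 0 → ord (a * b) = ord a + ord b) ∧
      (∀ (a : L) (n : ℕ), a ≠ 0 → ord (a ^ n) = n * ord a) ∧
      (∀ a : L, a ≠ 0 → (ord a = 0 ↔ valuation L a = 1)) ∧
      (∀ a : L, a ≠ 0 → (ord a < 0 ↔ valuation L a < 1)) := by
  set e := _root_.IsNonarchimedeanLocalField.valueGroupWithZeroIsoInt L with he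
  have hne : ∀ a : L, a ≠ 0 → e (valuation L a) ≠ 0 := fun a ha h =>
    ((Valuation.ne_zero_iff _).mpr ha) (e.injective (h.trans (map_zero e).symm))
  refine ⟨fun a => WithZero.log (e (valuation L a)), ?_, ?_, ?_, ?_⟩
  · intro a b ha hb
    show WithZero.log (e (valuation L (a * b))) = WithZero.log (e (valuation L a)) +
      WithZero.log (e (valuation L b))
    rw [map_mul, map_mul, WithZero.log_mul (hne a ha) (hne b hb)]
  · intro a n ha
    show WithZero.log (e (valuation L (a ^ n))) = n * WithZero.log (e (valuation L a))
    rw [map_pow, map_pow, WithZero.log_pow, nsmul_eq_mul]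
  · intro a ha
    show WithZero.log (e (valuation L a)) = 0 ↔ valuation L a = 1
    constructor
    · intro h
      have h1 : e (valuation L a) = 1 := by
        rw [← WithZero.exp_log (hne a ha), h, WithZero.exp_zero]
      exact e.injective (h1.trans (map_one e).symm)
    · intro h
      rw [h, map_one, WithZero.log_one]
  · intro a ha
    show WithZero.log (e (valuation L a)) < 0 ↔ valuation L a < 1
    rw [WithZero.log_lt_iff_lt_exp (hne a ha), WithZero.exp_zero, ← map_one e]
    exact map_lt_map_iff e

/-- The elements of an intermediate field that are units of `𝒪_k̄` are the elements of valuation `1`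
of that local field. Ref: Serre, *Local Fields*, Ch. II §2, Prop. 3. [cite: SerreLocalFields1979, Ch. II §2 Prop. 3] -/
private theorem coe_mem_unitSubmonoid_iff_valuation_eq_one (E : IntermediateField C.k C.K)
    [FiniteDimensional C.k E] {z : E} (hz : z ≠ 0) :
    letI := FiniteExtension.valuativeRel C.k E
    (z : C.K) ∈ unitSubmonoid C.k C.K ↔ valuation E z = 1 := by
  letI := FiniteExtension.valuativeRel C.k E
  rw [FiniteExtension.valuation_eq_one_iff_isIntegral_and_isIntegral_inv C.k E hz,
    mem_unitSubmonoid_iff]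
  have hz' : (z : C.K) ≠ 0 := fun h => hz (by exact_mod_cast h)
  have h1 := IntermediateField.isIntegral_coe_iff C.k C.K E z
  have h2 := IntermediateField.isIntegral_coe_iff C.k C.K E z⁻¹
  rw [IntermediateField.coe_inv] at h2
  exact ⟨fun h => ⟨h1.mp h.2.1, h2.mp h.2.2⟩, fun h => ⟨hz', h1.mpr h.1, h2.mpr h.2⟩⟩

/-- The elements of an intermediate field that are integers of `𝒪_k̄` are the elements of
valuation `≤ 1` of that local field. Ref: Serre, *Local Fields*, Ch. II §2, Prop. 3.
[cite: SerreLocalFields1979, Ch. II §2 Prop. 3] -/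
private theorem coe_mem_nonzeroIntegers_iff_valuation_le_one (E : IntermediateField C.k C.K)
    [FiniteDimensional C.k E] {z : E} (hz : z ≠ 0) :
    letI := FiniteExtension.valuativeRel C.k E
    (z : C.K) ∈ nonzeroIntegers C.k C.K ↔ valuation E z ≤ 1 := by
  letI := FiniteExtension.valuativeRel C.k E
  have hz' : (z : C.K) ≠ 0 := fun h => hz (by exact_mod_cast h)
  rw [← Valuation.mem_integer_iff, FiniteExtension.mem_integer_iff_isIntegral C.k E]
  have h1 := IntermediateField.isIntegral_coe_iff C.k C.K E z
  exact ⟨fun h => h1.mp h.1, fun h => ⟨h1.mpr h, hz'⟩⟩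

/-- **A uniformizer as anchor.**  There is `ϖ ∈ 𝒪_k̄^⊳` with `ϖ⁻¹ ∉ 𝒪_k̄^⊳` (a uniformizer of `k`
will do) such that every integral non-unit `x` satisfies `x^m = ϖⁿ·u` for some `m ≥ 1`, `n`, and a unit
`u` — the value group of the local field `k(x)` being discrete of finite index over that of `k`.
Ref: Serre, *Local Fields*, Ch. II §2. [cite: SerreLocalFields1979, Ch. II §2 Prop. 3] -/
theorem exists_anchor :
    ∃ ϖ : C.K, ϖ ∈ nonzeroIntegers C.k C.K ∧ ϖ⁻¹ ∉ nonzeroIntegers C.k C.K ∧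
      ∀ x : C.K, x ∈ nonzeroIntegers C.k C.K → x ∉ unitSubmonoid C.k C.K →
        ∃ m n : ℕ, 0 < m ∧ ∃ u ∈ unitSubmonoid C.k C.K, x ^ m = ϖ ^ n * u := by
  -- an element `ϖ₀ ∈ k` of valuation strictly between `0` and `1`
  obtain ⟨γ, hγ0, hγ1⟩ := ValuativeRel.IsNontrivial.exists_lt_one (R := C.k)
  obtain ⟨ϖ₀, hϖ₀⟩ := ValuativeRel.valuation_surjective γ
  have hϖ₀0 : ϖ₀ ≠ 0 := fun h => hγ0.ne' (by rw [← hϖ₀, h, map_zero])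
  have hϖ₀int : ϖ₀ ∈ 𝒪[C.k] := (Valuation.mem_integer_iff _ _).mpr (hϖ₀ ▸ hγ1.le)
  have hϖ₀inv : ϖ₀⁻¹ ∉ 𝒪[C.k] := by
    rw [Valuation.mem_integer_iff, map_inv₀, hϖ₀, not_le]
    exact one_lt_inv_iff₀.mpr ⟨hγ0, hγ1⟩
  refine ⟨algebraMap C.k C.K ϖ₀, ⟨(isIntegral_algebraMap_iff_mem_integer C.k C.K).mpr hϖ₀int,
    (map_ne_zero _).mpr hϖ₀0⟩, fun h => hϖ₀inv ?_, ?_⟩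
  · rw [← map_inv₀] at h
    exact (isIntegral_algebraMap_iff_mem_integer C.k C.K).mp h.1
  intro x hxint hxunit
  have hx : x ≠ 0 := hxint.2
  have hxk : IsIntegral C.k x := Algebra.IsIntegral.isIntegral x
  haveI : FiniteDimensional C.k (IntermediateField.adjoin C.k ({x} : Set C.K)) :=
    IntermediateField.adjoin.finiteDimensional hxk
  letI := FiniteExtension.valuativeRel C.k (IntermediateField.adjoin C.k ({x} : Set C.K))
  letI := FiniteExtension.topologicalSpace C.k (IntermediateField.adjoin C.k ({x} : Set C.K))
  haveI := FiniteExtension.isNonarchimedeanLocalField C.k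
    (IntermediateField.adjoin C.k ({x} : Set C.K))
  obtain ⟨ord, hmul, hpow, hzero, hneg⟩ :=
    exists_ord_fun (IntermediateField.adjoin C.k ({x} : Set C.K))
  -- the two players inside `L = k(x)`
  have hx'0 : IntermediateField.AdjoinSimple.gen C.k x ≠ 0 := fun h =>
    hx (congrArg (fun z : IntermediateField.adjoin C.k ({x} : Set C.K) => (z : C.K)) h)
  have hϖ'0 : algebraMap C.k (IntermediateField.adjoin C.k ({x} : Set C.K)) ϖ₀ ≠ 0 :=
    (map_ne_zero _).mpr hϖ₀0
  -- `ord x' < 0`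
  have hx'neg : ord (IntermediateField.AdjoinSimple.gen C.k x) < 0 := by
    rw [hneg _ hx'0, lt_iff_le_and_ne]
    refine ⟨(C.coe_mem_nonzeroIntegers_iff_valuation_le_one _ hx'0).mp hxint, fun h => hxunit ?_⟩
    exact (C.coe_mem_unitSubmonoid_iff_valuation_eq_one _ hx'0).mpr h
  -- `ord ϖ' < 0`
  have hϖ'neg : ord (algebraMap C.k (IntermediateField.adjoin C.k ({x} : Set C.K)) ϖ₀) < 0 := by
    rw [hneg _ hϖ'0, lt_iff_le_and_ne]
    constructor
    · rw [← Valuation.mem_integer_iff]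
      exact (FiniteExtension.mem_integer_algebraMap_iff C.k _ ϖ₀).mpr hϖ₀int
    · intro h
      apply hϖ₀inv
      have h2 := ((FiniteExtension.valuation_eq_one_iff_mem_integer_and_inv_mem C.k _ hϖ'0).mp h).2
      rw [← map_inv₀] at h2
      exact (FiniteExtension.mem_integer_algebraMap_iff C.k _ ϖ₀⁻¹).mp h2
  -- exponents: `m := -ord ϖ'`, `n := -ord x'`
  refine ⟨(-ord (algebraMap C.k (IntermediateField.adjoin C.k ({x} : Set C.K)) ϖ₀)).toNat,
    (-ord (IntermediateField.AdjoinSimple.gen C.k x)).toNat, by omega, ?_⟩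
  have hm : (((-ord (algebraMap C.k (IntermediateField.adjoin C.k ({x} : Set C.K)) ϖ₀)).toNat : ℕ)
      : ℤ) = -ord (algebraMap C.k (IntermediateField.adjoin C.k ({x} : Set C.K)) ϖ₀) :=
    Int.toNat_of_nonneg (by omega)
  have hn : (((-ord (IntermediateField.AdjoinSimple.gen C.k x)).toNat : ℕ) : ℤ) =
      -ord (IntermediateField.AdjoinSimple.gen C.k x) :=
    Int.toNat_of_nonneg (by omega)
  -- the unit `u := x'^m / ϖ'^n`
  set u := IntermediateField.AdjoinSimple.gen C.k x ^
      (-ord (algebraMap C.k (IntermediateField.adjoin C.k ({x} : Set C.K)) ϖ₀)).toNat *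
    (algebraMap C.k (IntermediateField.adjoin C.k ({x} : Set C.K)) ϖ₀ ^
      (-ord (IntermediateField.AdjoinSimple.gen C.k x)).toNat)⁻¹ with hu
  have hu0 : u ≠ 0 := mul_ne_zero (pow_ne_zero _ hx'0) (inv_ne_zero (pow_ne_zero _ hϖ'0))
  have hord_u : ord u = 0 := by
    have h3 : ord ((algebraMap C.k (IntermediateField.adjoin C.k ({x} : Set C.K)) ϖ₀ ^
          (-ord (IntermediateField.AdjoinSimple.gen C.k x)).toNat)⁻¹) +
        ord (algebraMap C.k (IntermediateField.adjoin C.k ({x} : Set C.K)) ϖ₀ ^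
          (-ord (IntermediateField.AdjoinSimple.gen C.k x)).toNat) = 0 := by
      rw [← hmul _ _ (inv_ne_zero (pow_ne_zero _ hϖ'0)) (pow_ne_zero _ hϖ'0),
        inv_mul_cancel₀ (pow_ne_zero _ hϖ'0), hzero _ one_ne_zero, map_one]
    rw [hpow _ _ hϖ'0, hn] at h3
    rw [hu, hmul _ _ (pow_ne_zero _ hx'0) (inv_ne_zero (pow_ne_zero _ hϖ'0)), hpow _ _ hx'0, hm]
    linear_combination h3
  refine ⟨(u : C.K), (C.coe_mem_unitSubmonoid_iff_valuation_eq_one _ hu0).mpr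
    ((hzero _ hu0).mp hord_u), ?_⟩
  have hid : IntermediateField.AdjoinSimple.gen C.k x ^
        (-ord (algebraMap C.k (IntermediateField.adjoin C.k ({x} : Set C.K)) ϖ₀)).toNat =
      algebraMap C.k (IntermediateField.adjoin C.k ({x} : Set C.K)) ϖ₀ ^
        (-ord (IntermediateField.AdjoinSimple.gen C.k x)).toNat * u := by
    rw [hu, mul_left_comm, mul_inv_cancel₀ (pow_ne_zero _ hϖ'0), mul_one]
  have := congrArg (fun z : IntermediateField.adjoin C.k ({x} : Set C.K) => (z : C.K)) hid
  simpa using this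

end MLFClosure

/-! ### §2. Arithmetic quotients of (model) pairs -/

/-- Membership in the arithmetic kernel: `g` acts trivially on `M`. [cite: MochizukiAbsTopIII2015, Definition 3.1 (ii) p.67] -/
theorem GaloisMonoidPair.mem_actionKer_iff (P : GaloisMonoidPair.{u}) (g : P.Pi) :
    g ∈ P.actionKer ↔ ∀ x : P.M, g • x = x := by
  rw [GaloisMonoidPair.actionKer, MonoidHom.mem_ker, MulEquiv.ext_iff]
  exact Iff.rfl

/-- An isomorphism of pairs maps the arithmetic kernel onto the arithmetic kernel (so its Galois
component "respects the arithmetic quotients"). [cite: MochizukiAbsTopIII2015, Definition 3.1 (ii) p.67] -/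
theorem GaloisMonoidPair.Iso.map_actionKer {P Q : GaloisMonoidPair.{u}} (e : GaloisMonoidPair.Iso P Q) :
    P.actionKer.map e.isoPi.toMulEquiv.toMonoidHom = Q.actionKer := by
  ext h
  rw [Subgroup.mem_map]
  constructor
  · rintro ⟨g, hg, rfl⟩
    rw [GaloisMonoidPair.mem_actionKer_iff] at hg ⊢
    intro y
    obtain ⟨x, rfl⟩ := e.isoM.surjective y
    show e.isoPi g • e.isoM x = e.isoM x
    rw [← e.smul_comm, hg]
  · intro hh
    refine ⟨e.isoPi.symm h, ?_, ContinuousMulEquiv.apply_symm_apply _ _⟩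
    rw [GaloisMonoidPair.mem_actionKer_iff] at hh ⊢
    intro x
    apply e.isoM.injective
    rw [e.smul_comm, ContinuousMulEquiv.apply_symm_apply, hh]

/-- The inverse Galois component also maps kernel onto kernel. [cite: MochizukiAbsTopIII2015, Definition 3.1 (ii) p.67] -/
theorem GaloisMonoidPair.Iso.symm_map_actionKer {P Q : GaloisMonoidPair.{u}}
    (e : GaloisMonoidPair.Iso P Q) :
    Q.actionKer.map e.isoPi.symm.toMulEquiv.toMonoidHom = P.actionKer := by
  have hc : e.isoPi.symm.toMulEquiv.toMonoidHom.comp e.isoPi.toMulEquiv.toMonoidHom =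
      MonoidHom.id _ := MonoidHom.ext fun g => e.isoPi.symm_apply_apply g
  rw [← e.map_actionKer, Subgroup.map_map, hc, Subgroup.map_id]

/-- For the model `TM`-pair the arithmetic kernel is `Ker ε_k` (`G_k` acts faithfully on `𝒪_k̄^⊳`).
[cite: MochizukiAbsTopIII2015, Definition 3.1 (ii) p.67] -/
theorem ModelMLFGaloisData.tmPair_actionKer (C : MLFClosure.{0}) (D : ModelMLFGaloisData C.k C.K) :
    D.tmPair.actionKer = D.aug.ker := by
  ext g
  rw [GaloisMonoidPair.mem_actionKer_iff, MonoidHom.mem_ker]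
  constructor
  · intro h
    exact C.algEquiv_eq_one_of_forall_nonzeroIntegers (D.aug g) fun x hx =>
      congrArg Subtype.val (h ⟨x, hx⟩)
  · intro h x
    apply Subtype.ext
    show D.aug g • (x : C.K) = x
    rw [h, one_smul]

/-- For the model `TLG`-pair the arithmetic kernel is `Ker ε_k` (`G_k` acts faithfully on `k̄^×`).
[cite: MochizukiAbsTopIII2015, Definition 3.1 (ii) p.67] -/
theorem ModelMLFGaloisData.tlgPair_actionKer (C : MLFClosure.{0}) (D : ModelMLFGaloisData C.k C.K) :
    D.tlgPair.actionKer = D.aug.ker := by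
  ext g
  rw [GaloisMonoidPair.mem_actionKer_iff, MonoidHom.mem_ker]
  constructor
  · intro h
    apply AlgEquiv.ext
    intro x
    by_cases hx : x = 0
    · rw [hx, map_zero]
      rfl
    exact congrArg Subtype.val (h ⟨x, mem_nonZeroDivisors_of_ne_zero hx⟩)
  · intro h x
    apply Subtype.ext
    show D.aug g • (x : C.K) = x
    rw [h, one_smul]


end Literature.AnabelianGeometry.AbsoluteAnabelian

end
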